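import Summits.QuantumFields.YangMills.Theorems.UnitScaleTiltFluctuationComparisonRegPrLiftLegsAvg
import Summits.QuantumFields.YangMills.Theorems.UnitScaleTiltFluctuationComparisonRegPrLiftFaceKernel
import Summits.QuantumFields.YangMills.Theorems.UnitScaleTiltFluctuationComparisonRegPrApproxLiftGauge

/-!
# Route `UnitScaleTilt` — crux K1bR-pr `FluctuationComparisonRegPr` (stmt-QuantumFields-19201 → `…L`), stub `stub_oneStepSmallLift`, piece (L2)
# for INTERIOR-SUPPORTED corrections — the Γ-LEG LAYER, file 3: THE SPLIT OF THE LEG FUNCTIONALS; THE STAIRCASE FUNCTIONAL IS A COARSE GAUGE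
# TRANSFORMATION (support file `--supports stmt-QuantumFields-19201`)

Cell `ym3-torus` (HUMAN RULING D-0037, YM ladder rung R3), seat `ym3-torus-p1` gen 11 (UV side; cell memo HOME/UV3-NODE.md §20).  File 2
(`…LiftLegsAvg`) gave, for `U⋆ = E · faceSec V` with an ARBITRARY correction `E` (`dist1 (E b) ≤ s`), `Ū⋆(c) = V(c) + inLin·V(c) + V(c)·outLin + O((ms)²)`
with the in- and out-leg functionals = means of signed sums of `E − 1` along the in- and out-walks.  Here:

* §1 `walkSum_walk_wordRev` (`Y(−Γ) = −Y(Γ)` exactly), `walkSum_sub`, `walkSum_mem_su`.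
* §2 the SPLIT: `inLin E c = stairLin E c₋ + rowInLin E c`, `outLin E c = rowOutLin E c − stairLin E c₊` (`inLin_eq`, `outLin_eq`) — the
  STAIRCASE FUNCTIONAL `stairLin E y = |I|⁻¹ Σ_{(r,σ,·)} Y_E(Γ^σ_{y,r})` depends on the block `y` only (the orderings `σ ↔ σ′` are exchangeable,
  `Fintype.sum_equiv`), the ROW FUNCTIONALS collect the in-block part of the rows (exit bond included; frame `c₋`) and the far part (frame `c₊`).
* §3 the COARSE GAUGE TRANSFORMATION `legGauge E y := expSU (stairLog E y)` (`stairLog` = the staircase functional of the bond LOGARITHMS, an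
  element of `𝔰𝔲(N)`): `‖legGauge E y − 1 − stairLin E y‖ ≤ 6(ms)²`, `‖(legGauge E y)⁻¹ − 1 + stairLin E y‖ ≤ 6(ms)²`.
File 4 (`…LiftLegsStep`) combines §2–§3 with file 2's head theorem: `Ū⋆(c) = V^{g_E}(c) + (rowInLin·V(c) + V(c)·rowOutLin) + O((ms)²)` and
`ApproxLiftStep` from a correction recipe with small LINE FUNCTIONAL (generalised S-neutrality).  Elementary; nothing of Bałaban's is asserted.
-/

noncomputable section

open scoped BigOperators

namespace Summit.QuantumFields.YangMills.Theorems.ApproxLift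

open Literature.MathematicalPhysics.QuantumFieldTheory.Balaban1983to89
open T4Continuum BlockAveraging AveragingRT B10Eq47AxialChi BlockAveragingSection BlockAveragingSectionPlaq
open NormedSpace ExpMeanLog MatrixLog
open scoped Matrix.Norms.L2Operator
open Summit.QuantumFields.YangMills.Theorems.AvgActionDefect (norm_mean_le)
open BlockAveragingEMLLinearised (walkSum walkSum_nil walkSum_cons walkSum_append length_walk length_walk_stairWord_le)
open Summit.QuantumFields.BalabanUV.T4Continuum.Spine.NE7 (walkEnd_emb_stairWord)

variable {P : Params} {j : ℕ}

/-! ## §1 Signed sums: reversed walks, differences, the Lie algebra -/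

section Walks

variable {W : Type*} [AddCommGroup W]

/-- **`Y(−Γ) = −Y(Γ)`** EXACTLY: the signed sum along the reversed walk (from the end of `Γ`) is minus the signed sum along `Γ`. -/
theorem walkSum_walk_wordRev (Y : PBond P j → W) : ∀ (x : Site P j) (w : List (Letter P.d)),
    walkSum Y (walk (walkEnd x w) (wordRev w)) = -walkSum Y (walk x w)
  | x, [] => by simp [walk, walkEnd, wordRev, walkSum]
  | x, (μ, true) :: w => by
    rw [wordRev_cons]
    show walkSum Y (walk (walkEnd (x.shift μ) w) (wordRev w ++ [Letter.flip (μ, true)])) = -walkSum Y (walk x ((μ, true) :: w))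
    rw [walk_append, walkSum_append, walkSum_walk_wordRev Y (x.shift μ) w, walkEnd_walkEnd_wordRev]
    simp only [Letter.flip, Bool.not_true, walk, walkSum_cons, walkSum_nil, Site.unshift_shift, Bool.false_eq_true, if_false,
      if_true, add_zero]
    abel
  | x, (μ, false) :: w => by
    rw [wordRev_cons]
    show walkSum Y (walk (walkEnd (x.unshift μ) w) (wordRev w ++ [Letter.flip (μ, false)])) = -walkSum Y (walk x ((μ, false) :: w))
    rw [walk_append, walkSum_append, walkSum_walk_wordRev Y (x.unshift μ) w, walkEnd_walkEnd_wordRev]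
    simp only [Letter.flip, Bool.not_false, walk, walkSum_cons, walkSum_nil, Bool.false_eq_true, if_false, if_true, add_zero]
    abel

/-- `walkSum` is linear in the bond field: differences. -/
theorem walkSum_sub (Y Y' : PBond P j → W) : ∀ γ : List (LStep P j), walkSum (Y - Y') γ = walkSum Y γ - walkSum Y' γ
  | [] => by simp [walkSum]
  | s :: γ => by
    rw [walkSum_cons, walkSum_cons, walkSum_cons, walkSum_sub Y Y' γ]
    simp only [Pi.sub_apply]
    split_ifs <;> abel

end Walks

section Su

variable {n : Type*} [Fintype n]

/-- Signed sums of `𝔰𝔲(N)`-valued bond fields are in `𝔰𝔲(N)`. -/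
theorem walkSum_mem_su {Y : PBond P j → Matrix n n ℂ} (hY : ∀ b, Y b ∈ skewAdjoint (Matrix n n ℂ) ∧ (Y b).trace = 0) :
    ∀ γ : List (LStep P j), walkSum Y γ ∈ skewAdjoint (Matrix n n ℂ) ∧ (walkSum Y γ).trace = 0
  | [] => by simp [walkSum]
  | s :: γ => by
    rw [walkSum_cons]
    obtain ⟨h1, h2⟩ := walkSum_mem_su hY γ
    by_cases hs : s.fwd
    · simp only [hs, if_true]
      exact ⟨add_mem (hY s.bond).1 h1, by rw [Matrix.trace_add, (hY s.bond).2, h2, add_zero]⟩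
    · simp only [hs, Bool.false_eq_true, if_false]
      exact ⟨add_mem (neg_mem (hY s.bond).1) h1, by rw [Matrix.trace_add, Matrix.trace_neg, (hY s.bond).2, h2, neg_zero, add_zero]⟩

end Su

/-! ## §2 The split of the leg functionals: staircase part (per block) and row part (per coarse bond) -/

section Split

variable {n : Type*} [Fintype n] [DecidableEq n] [Nonempty n]

/-- **THE STAIRCASE FUNCTIONAL OF THE BLOCK `y`**: `|I|⁻¹ Σ_{(r,σ,σ′)} Y_E(Γ^σ_{y,r})` — the mean over the base points and orderings of the signed sums
of `Y_E = E − 1` along the staircases of `B(y)` from its centre (it depends on `E` on bonds of `B(y)` only; the second ordering is dummy). -/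
def stairLin (E : GaugeField P j (Matrix.specialUnitaryGroup n ℂ)) (y : Site P (j + 1)) : Matrix n n ℂ :=
  ((Fintype.card (Idx P) : ℂ))⁻¹ • ∑ i : Idx P, walkSum (corrY E) (walk (emb y) (stairWord i.2.1 (off i.1)))

/-- **THE IN-ROW FUNCTIONAL OF `c`** (frame `c₋`): `|I|⁻¹ Σ_{(r,·,·)} Y_E([x_r, x_r + (L − r_μ)e_μ])` — the in-block parts of the rows, exit bonds included. -/
def rowInLin (E : GaugeField P j (Matrix.specialUnitaryGroup n ℂ)) (c : PBond P (j + 1)) : Matrix n n ℂ :=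
  ((Fintype.card (Idx P) : ℂ))⁻¹ • ∑ i : Idx P,
    walkSum (corrY E) (walk (Site.blockSite c.src i.1) (List.replicate (P.L - (i.1 c.dir : ℕ)) (c.dir, true)))

/-- **THE OUT-ROW FUNCTIONAL OF `c`** (frame `c₊`): `|I|⁻¹ Σ_{(r,·,·)} Y_E([x_r + (L − r_μ)e_μ, x_r + Le_μ])` — the far parts of the rows. -/
def rowOutLin (E : GaugeField P j (Matrix.specialUnitaryGroup n ℂ)) (c : PBond P (j + 1)) : Matrix n n ℂ :=
  ((Fintype.card (Idx P) : ℂ))⁻¹ • ∑ i : Idx P, walkSum (corrY E) (walk (outBase c i.1) (List.replicate (i.1 c.dir : ℕ) (c.dir, true)))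

omit [Nonempty n] in
/-- **`inLin = stairLin(c₋) + rowInLin`** (exact). -/
theorem inLin_eq (E : GaugeField P j (Matrix.specialUnitaryGroup n ℂ)) (c : PBond P (j + 1)) :
    inLin E c = stairLin E c.src + rowInLin E c := by
  unfold inLin stairLin rowInLin
  rw [← smul_add, ← Finset.sum_add_distrib]
  congr 1
  refine Finset.sum_congr rfl fun i _ => ?_
  rw [inWord, walk_append, walkSum_append, walkEnd_emb_stairWord]

/-- The out-walk's signed sum: the far row part minus the staircase of `B(c₊)` (exact; standing range). -/
theorem walkSum_outWalk (hj : j + 1 ≤ P.m + P.K) {W : Type*} [AddCommGroup W] (Y : PBond P j → W) (c : PBond P (j + 1))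
    (r : Fin P.d → Fin P.L) (σ' : Equiv.Perm (Fin P.d)) :
    walkSum Y (walk (outBase c r) (outWord c r σ')) =
      walkSum Y (walk (outBase c r) (List.replicate (r c.dir : ℕ) (c.dir, true))) - walkSum Y (walk (emb c.tgt) (stairWord σ' (off r))) := by
  rw [outWord, walk_append, walkSum_append, walkEnd_outBase_replicate hj c r σ', walkSum_walk_wordRev, sub_eq_add_neg]

omit [Nonempty n] in
/-- **`outLin = rowOutLin − stairLin(c₊)`** (exact; standing range; the orderings `σ ↔ σ′` are exchangeable in the mean). -/
theorem outLin_eq (hj : j + 1 ≤ P.m + P.K) (E : GaugeField P j (Matrix.specialUnitaryGroup n ℂ)) (c : PBond P (j + 1)) :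
    outLin E c = rowOutLin E c - stairLin E c.tgt := by
  have hsw : ∑ i : Idx P, walkSum (corrY E) (walk (emb c.tgt) (stairWord i.2.2 (off i.1))) =
      ∑ i : Idx P, walkSum (corrY E) (walk (emb c.tgt) (stairWord i.2.1 (off i.1))) :=
    Fintype.sum_equiv (Equiv.prodCongr (Equiv.refl _) (Equiv.prodComm _ _)) _ _ fun _ => rfl
  unfold outLin stairLin rowOutLin
  rw [← smul_sub, ← hsw, ← Finset.sum_sub_distrib]
  congr 1
  exact Finset.sum_congr rfl fun i _ => walkSum_outWalk hj (corrY E) c i.1 i.2.2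

omit [Nonempty n] in
/-- A mean of signed sums along walks of at most `m` steps has norm `≤ ms`. -/
theorem norm_mean_walkSum_le {Y : PBond P j → Matrix n n ℂ} {s : ℝ} (hY : ∀ b, ‖Y b‖ ≤ s) (s0 : 0 ≤ s)
    (γ : Idx P → List (LStep P j)) {m : ℕ} (hγ : ∀ i, (γ i).length ≤ m) :
    ‖((Fintype.card (Idx P) : ℂ))⁻¹ • ∑ i : Idx P, walkSum Y (γ i)‖ ≤ m * s :=
  norm_mean_le (fun i => (norm_walkSum_le Y hY (γ i)).trans (mul_le_mul_of_nonneg_right (by exact_mod_cast hγ i) s0))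
    (by positivity)

/-- `‖stairLin E y‖ ≤ ms`. -/
theorem norm_stairLin_le {E : GaugeField P j (Matrix.specialUnitaryGroup n ℂ)} {s : ℝ} (hE : ∀ b, dist1 (E b) ≤ s) (s0 : 0 ≤ s)
    (y : Site P (j + 1)) : ‖stairLin E y‖ ≤ (legLen P) * s := by
  refine norm_mean_walkSum_le (norm_corrY_le hE) s0 _ fun i => ?_
  refine (length_walk_stairWord_le (emb y) i.2.1 i.1).trans ?_
  unfold legLen
  exact Nat.mul_le_mul_right _ (by omega)

end Split

/-! ## §3 The staircase functional of the logarithms is an `𝔰𝔲(N)` element: the coarse gauge transformation -/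

section Gauge

variable {n : Type*} [Fintype n] [DecidableEq n] [Nonempty n]

/-- In the model, `dist1 g = ‖g − 1‖`. -/
private theorem dist1_su_eq₄ (g : Matrix.specialUnitaryGroup n ℂ) : dist1 g = ‖(g : Matrix n n ℂ) - 1‖ := rfl

/-- A special unitary matrix has operator norm `≤ 1`. -/
private theorem norm_coe_su_le_one₄ (g : Matrix.specialUnitaryGroup n ℂ) : ‖(g : Matrix n n ℂ)‖ ≤ 1 :=
  (UnitaryModel.norm_of_mem_unitaryGroup (Matrix.specialUnitaryGroup_le_unitaryGroup g.2)).le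

/-- The bondwise LOGARITHM of the correction, `log E(b)`. -/
def corrLog (E : GaugeField P j (Matrix.specialUnitaryGroup n ℂ)) : PBond P j → Matrix n n ℂ :=
  fun b => mlog ((E b : Matrix.specialUnitaryGroup n ℂ) : Matrix n n ℂ)

/-- **THE STAIRCASE FUNCTIONAL OF THE LOGARITHMS** of block `y` (an element of `𝔰𝔲(N)` on small corrections). -/
def stairLog (E : GaugeField P j (Matrix.specialUnitaryGroup n ℂ)) (y : Site P (j + 1)) : Matrix n n ℂ :=
  ((Fintype.card (Idx P) : ℂ))⁻¹ • ∑ i : Idx P, walkSum (corrLog E) (walk (emb y) (stairWord i.2.1 (off i.1)))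

/-- **THE COARSE GAUGE TRANSFORMATION OF THE LEGS**: `g_E(y) = exp (stairLog E y) ∈ SU(N)`. -/
def legGauge (E : GaugeField P j (Matrix.specialUnitaryGroup n ℂ)) : GaugeTransf P (j + 1) (Matrix.specialUnitaryGroup n ℂ) :=
  fun y => expSU (stairLog E y)

variable {E : GaugeField P j (Matrix.specialUnitaryGroup n ℂ)} {s : ℝ}

/-- `log E(b) ∈ 𝔰𝔲(N)` for `dist1 (E b) ≤ s ≤ 1/3`, `N·s < π`. -/
theorem corrLog_mem (hE : ∀ b, dist1 (E b) ≤ s) (hs3 : s ≤ 1 / 3) (hπ : Fintype.card n * s < Real.pi) (b : PBond P j) :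
    corrLog E b ∈ skewAdjoint (Matrix n n ℂ) ∧ (corrLog E b).trace = 0 := by
  have h : ‖((E b : Matrix.specialUnitaryGroup n ℂ) : Matrix n n ℂ) - 1‖ ≤ s := hE b
  refine ⟨star_mlog_eq_neg (Matrix.specialUnitaryGroup_le_unitaryGroup (E b).2) (h.trans hs3),
    trace_mlog_eq_zero (E b).2 (h.trans hs3) ?_⟩
  exact lt_of_le_of_lt (mul_le_mul_of_nonneg_left h (Nat.cast_nonneg _)) hπ

/-- `stairLog E y ∈ 𝔰𝔲(N)`. -/
theorem stairLog_mem (hE : ∀ b, dist1 (E b) ≤ s) (hs3 : s ≤ 1 / 3) (hπ : Fintype.card n * s < Real.pi) (y : Site P (j + 1)) :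
    stairLog E y ∈ skewAdjoint (Matrix n n ℂ) ∧ (stairLog E y).trace = 0 := by
  have h := sum_smul_mem_su (Finset.univ : Finset (Idx P)) (fun _ => ((Fintype.card (Idx P) : ℝ))⁻¹)
    (fun i => walkSum (corrLog E) (walk (emb y) (stairWord i.2.1 (off i.1))))
    fun i _ => walkSum_mem_su (corrLog_mem hE hs3 hπ) _
  have hrw : stairLog E y = ∑ i : Idx P, ((((Fintype.card (Idx P) : ℝ))⁻¹ : ℝ) : ℂ) •
      walkSum (corrLog E) (walk (emb y) (stairWord i.2.1 (off i.1))) := by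
    unfold stairLog
    rw [Finset.smul_sum]
    refine Finset.sum_congr rfl fun i _ => ?_
    congr 1
    push_cast
    rfl
  rw [hrw]
  exact h

/-- `g_E(y) = exp (stairLog E y)` as a matrix. -/
theorem coe_legGauge (hE : ∀ b, dist1 (E b) ≤ s) (hs3 : s ≤ 1 / 3) (hπ : Fintype.card n * s < Real.pi) (y : Site P (j + 1)) :
    ((legGauge E y : Matrix.specialUnitaryGroup n ℂ) : Matrix n n ℂ) = exp (stairLog E y) :=
  coe_expSU (stairLog_mem hE hs3 hπ y).1 (stairLog_mem hE hs3 hπ y).2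

/-- `g_E(y)⁻¹ = exp (−stairLog E y)` as a matrix. -/
theorem coe_legGauge_inv (hE : ∀ b, dist1 (E b) ≤ s) (hs3 : s ≤ 1 / 3) (hπ : Fintype.card n * s < Real.pi) (y : Site P (j + 1)) :
    (((legGauge E y)⁻¹ : Matrix.specialUnitaryGroup n ℂ) : Matrix n n ℂ) = exp (-stairLog E y) := by
  have hinv : (((legGauge E y)⁻¹ : Matrix.specialUnitaryGroup n ℂ) : Matrix n n ℂ) =
      star ((legGauge E y : Matrix.specialUnitaryGroup n ℂ) : Matrix n n ℂ) := rfl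
  have hs := (stairLog_mem hE hs3 hπ y).1
  rw [skewAdjoint.mem_iff] at hs
  rw [hinv, coe_legGauge hE hs3 hπ, star_exp, hs]

/-- `‖log E(b) − (E(b) − 1)‖ ≤ 2s²` (`s ≤ 1/3`). -/
theorem norm_corrLog_sub_corrY_le (hE : ∀ b, dist1 (E b) ≤ s) (hs3 : s ≤ 1 / 3) (b : PBond P j) :
    ‖(corrLog E - corrY E) b‖ ≤ 2 * s ^ 2 := by
  have h : ‖((E b : Matrix.specialUnitaryGroup n ℂ) : Matrix n n ℂ) - 1‖ ≤ s := hE b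
  have s0 : 0 ≤ s := (norm_nonneg _).trans h
  show ‖mlog ((E b : Matrix.specialUnitaryGroup n ℂ) : Matrix n n ℂ) - (((E b : Matrix.specialUnitaryGroup n ℂ) : Matrix n n ℂ) - 1)‖ ≤ _
  calc _ ≤ 2 * ‖((E b : Matrix.specialUnitaryGroup n ℂ) : Matrix n n ℂ) - 1‖ ^ 2 :=
        Summit.QuantumFields.BalabanUV.Beta.EriceAxialGaugeWords.norm_mlog_sub_sub_one_le (h.trans (hs3.trans (by norm_num)))
    _ ≤ 2 * s ^ 2 := by gcongr

/-- `‖log E(b)‖ ≤ 2s` (`s ≤ 1/3`). -/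
theorem norm_corrLog_le (hE : ∀ b, dist1 (E b) ≤ s) (hs3 : s ≤ 1 / 3) (b : PBond P j) : ‖corrLog E b‖ ≤ 2 * s := by
  have h : ‖((E b : Matrix.specialUnitaryGroup n ℂ) : Matrix n n ℂ) - 1‖ ≤ s := hE b
  exact (norm_mlog_le_two_mul (h.trans (hs3.trans (by norm_num)))).trans (by linarith)

/-- `‖stairLog E y − stairLin E y‖ ≤ 2ms²` and `‖stairLog E y‖ ≤ 2ms`. -/
theorem norm_stairLog_sub_stairLin_le (hE : ∀ b, dist1 (E b) ≤ s) (hs3 : s ≤ 1 / 3) (y : Site P (j + 1)) :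
    ‖stairLog E y - stairLin E y‖ ≤ (legLen P) * (2 * s ^ 2) ∧ ‖stairLog E y‖ ≤ (legLen P) * (2 * s) := by
  have s0 : 0 ≤ s := (GaugeGroup.dist1_nonneg _).trans (hE ⟨emb y, ⟨0, P.hd⟩⟩)
  have hlen : ∀ i : Idx P, (walk (emb y) (stairWord i.2.1 (off i.1))).length ≤ legLen P := fun i =>
    (length_walk_stairWord_le (emb y) i.2.1 i.1).trans (by unfold legLen; exact Nat.mul_le_mul_right _ (by omega))
  refine ⟨?_, norm_mean_walkSum_le (norm_corrLog_le hE hs3) (by positivity) _ hlen⟩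
  have hrw : stairLog E y - stairLin E y =
      ((Fintype.card (Idx P) : ℂ))⁻¹ • ∑ i : Idx P, walkSum (corrLog E - corrY E) (walk (emb y) (stairWord i.2.1 (off i.1))) := by
    unfold stairLog stairLin
    rw [← smul_sub, ← Finset.sum_sub_distrib]
    congr 1
    exact Finset.sum_congr rfl fun i _ => (walkSum_sub _ _ _).symm
  rw [hrw]
  exact norm_mean_walkSum_le (norm_corrLog_sub_corrY_le hE hs3) (by positivity) _ hlen

/-- **THE GAUGE TRANSFORMATION TO FIRST ORDER**: `‖g_E(y) − 1 − stairLin E y‖ ≤ 6(ms)²` and `‖g_E(y)⁻¹ − 1 + stairLin E y‖ ≤ 6(ms)²`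
(`2ms ≤ 1`, `s ≤ 1/3`, `N·s < π`; `m = (d+3)L ≥ 1`). -/
theorem norm_legGauge_sub_le (hE : ∀ b, dist1 (E b) ≤ s) (hs3 : s ≤ 1 / 3) (hπ : Fintype.card n * s < Real.pi)
    (hms : 2 * (legLen P) * s ≤ 1) (y : Site P (j + 1)) :
    ‖((legGauge E y : Matrix.specialUnitaryGroup n ℂ) : Matrix n n ℂ) - 1 - stairLin E y‖ ≤ 6 * ((legLen P) * s) ^ 2 ∧
      ‖(((legGauge E y)⁻¹ : Matrix.specialUnitaryGroup n ℂ) : Matrix n n ℂ) - 1 + stairLin E y‖ ≤ 6 * ((legLen P) * s) ^ 2 := by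
  obtain ⟨hdiff, hlog⟩ := norm_stairLog_sub_stairLin_le hE hs3 y
  have s0 : 0 ≤ s := (GaugeGroup.dist1_nonneg _).trans (hE ⟨emb y, ⟨0, P.hd⟩⟩)
  have m1 : (1 : ℝ) ≤ legLen P := by
    have : 1 ≤ legLen P := le_trans P.L_pos (Nat.le_mul_of_pos_left _ (by omega))
    exact_mod_cast this
  set m : ℝ := (legLen P : ℝ) with hm
  set ψ := stairLog E y with hψ
  set φ := stairLin E y with hφ
  have hψ1 : ‖ψ‖ ≤ 1 := hlog.trans (by linarith)
  letI : NormedAlgebra ℝ (Matrix n n ℂ) := NormedAlgebra.restrictScalars ℝ ℂ (Matrix n n ℂ)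
  have hexp : ‖exp ψ - 1 - ψ‖ ≤ (m * (2 * s)) ^ 2 :=
    (Literature.MathematicalPhysics.QuantumFieldTheory.OneLinkLaplace.norm_exp_sub_one_sub_le_sq hψ1).trans (by gcongr)
  have hexp' : ‖exp (-ψ) - 1 - (-ψ)‖ ≤ (m * (2 * s)) ^ 2 :=
    (Literature.MathematicalPhysics.QuantumFieldTheory.OneLinkLaplace.norm_exp_sub_one_sub_le_sq (by rwa [norm_neg])).trans
      (by rw [norm_neg]; gcongr)
  -- `m s² ≤ (m s)²` since `m ≥ 1`
  have hms2 : m * (2 * s ^ 2) ≤ 2 * (m * s) ^ 2 := by nlinarith [sq_nonneg s, mul_nonneg (sub_nonneg.2 m1) (sq_nonneg s)]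
  constructor
  · rw [coe_legGauge hE hs3 hπ]
    have e : exp ψ - 1 - φ = (exp ψ - 1 - ψ) + (ψ - φ) := by abel
    rw [e]
    calc _ ≤ ‖exp ψ - 1 - ψ‖ + ‖ψ - φ‖ := norm_add_le _ _
      _ ≤ (m * (2 * s)) ^ 2 + m * (2 * s ^ 2) := add_le_add hexp hdiff
      _ ≤ 6 * (m * s) ^ 2 := by nlinarith
  · rw [coe_legGauge_inv hE hs3 hπ]
    have e : exp (-ψ) - 1 + φ = (exp (-ψ) - 1 - (-ψ)) - (ψ - φ) := by abel
    rw [e]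
    calc _ ≤ ‖exp (-ψ) - 1 - (-ψ)‖ + ‖ψ - φ‖ := norm_sub_le _ _
      _ ≤ (m * (2 * s)) ^ 2 + m * (2 * s ^ 2) := add_le_add hexp' hdiff
      _ ≤ 6 * (m * s) ^ 2 := by nlinarith

end Gauge

end Summit.QuantumFields.YangMills.Theorems.ApproxLift

end
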